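import Summits.QuantumFields.YangMills.Theorems.BalabanUVNodesN07Thm4RecSym152PhiEGOfJunctionGlued
import Summits.QuantumFields.YangMills.Theorems.BalabanUVNodesN07Prop8StepCoPGridGOfPremisesG
import Summits.QuantumFields.YangMills.Theorems.BalabanUVNodesN07JunctionHnumOfSmallness
import Summits.QuantumFields.YangMills.Theorems.BalabanUVNodesN07JunctionHJ
import Summits.QuantumFields.YangMills.Theorems.BalabanUVNodesN07DatumCrownPhiOfRecordCrownPrecomp
import Summits.QuantumFields.YangMills.Theorems.BalabanUVNodesN07RecordCrownSUPrecomp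
import HarnessLib

/-!
# N07 [B11] (= [15] = [Balaban1985Variational]) Sect. F — MODULE 140: **THE `hsup` PACKAGING — (P1′-G) FROM THE PRE-COMPOSED RECORD CROWN AND THE JUNCTION's `hJ_holds`, AND
# K0⁷ STUB 1 `Prop8StepCoPGridGAt F` FROM THE CROWN ∧ HSEAM** — the chart side's last composition: per collar multiple `ρ₀` the crown's constants `Cr = 560L³B₀·sideP`, `Cω = 20LB₀`,
# `α₁ = c₁∕(56L²·sideP)`, `ω₁ = c₁∕2` (dag-n07-w3 ✓`datumCrownPhiAt_of_recordCrownSUPrecompBody`), a `κ` linear in `ρ₀` (MODULE 139b `exists_kappa_choice`), a small fine letter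
# `a₀` (`exists_fineLetter_small`), `ψc := 65536·((830352 + 4Cr + 59719680Cω)L⁵)²∕κ²`, the numerics `hnum_of_smallness`, the junction's `hJ_holds` (dag-n07-w3 MODULE 35b) and
# MODULE 133′ `hThm4RecSym152PhiEG_of_junction_glued` give every member of (P1′-G) at `md := s + 1`, `ρmin := lcm (L^s) ρmin_crown`; MODULE 125 then gives the stub from HSEAM

Cell `pub-ymgap`, seat `pub-ymgap-dag-n07-e` g33 (FAN-OUT §N07 row s3; LANE OWNER of the K0 road chart side).  `--kind proof --supports stmt-QuantumFields-20541 --as helper` (K0⁷;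
count-neutral).  THREE theorems, 0 `def`.  [15] = [Balaban1985Variational]; [6] = [Balaban1985RegularSpaces]; [III] = [Balaban1988Convergent]; [I] = [Balaban1987RG1].

WHY.  After MODULES 133′∕134′ (glued skeleton), 138 (`hvfix`), 139∕139b (numerics) and the junction's 34∕35a∕35b (`(h, X, ω)`, prelims, ★★★ `hJ_holds`: 133′'s `hJ` binder inhabited
MODULO the 19-row `hnum`), the displayed premise `hsup` of MODULE 134′ is pure ∃-plumbing: the record crown `RecordCrownSUPrecomp F.L N` (dag-n05-e's F8 + socket v1.1 ✓p762215:
UNCONDITIONAL for `N ≤ 25`) ⇒ its body `(B₀ ≥ 1, c₁ > 0, …)` ⇒ per `ρ₀` (`ρmin_crown ∣ ρ₀`) the φ-crown `DatumCrownPhiAt F N Mc (ρ₀L) hρ s Cr Cω α₁ ω₁`; `exists_kappa_choice` ⇒ `κ` with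
`4(Cr + 14929920Cω)L⁸ < κ ≤ Aκ·ρ₀`; `exists_fineLetter_small` ⇒ `a₀ > 0` meeting the eight rows and `L³a₀ ≤ α₁`; `hnum_of_smallness` ⇒ `hnum`; `hJ_holds` ⇒ the glued `hJ`; 133′ ⇒
`HThm4RecSym152PhiEG F N Mc (ρ₀L) (L^{s+1}) κ a₀ (ψc·(κ·ε)²)`.  The collar modulus is `lcm (L^s) ρmin_crown` (133′ needs `L^{s+1} ∣ ρ₀L`, the crown needs `ρmin_crown ∣ ρ₀`; (P1′-G)'s
`∃ ρmin` absorbs both — this is why MODULE 134′'s `F.L^s ∣ ρ₀` edition is bypassed and 133′ is called directly).  With HSEAM, MODULE 125 ✓p753627 gives the registered stub-1 text at `N = 2`.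

WHAT IS PROVED (sorry-free; axioms standard).  ★★★ `sym152PhiEG_uniform_of_recordCrown` ((P1′-G) for any `N` from `RecordCrownSUPrecomp F.L N`); ★★★ `prop8StepCoPGridGAt_of_recordCrown_of_seam`
(`N = 2`: `RecordCrownSUPrecomp F.L 2` ∧ HSEAM ⇒ `K0V22ZDefs.Prop8StepCoPGridGAt F`); ★★★ `prop8StepCoPGridGAt_of_seam` (the crown discharged by ✓`recordCrownSUPrecomp_holds_of_le` (`2 ≤ 25`):
**stub 1 ⟸ HSEAM alone**, `1 ≤ Mc`).
HONEST FRAMING: count-neutral composition of landed names; HSEAM (the (ii)-docket: the genSet seam `bondsOf ⊋ Domains.LamBond`, director's column) is a DISPLAYED premise inhabited by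
nobody — K0⁷ stub 1 is NOT closed by this file; nothing of [15]∕[6]∕[III]∕[I] asserted beyond the cited modules; `HThm4RecSym152PhiEG` holds here per member only as 133′'s conclusion
under the junction's theorems; `HThm4Rec*` otherwise UNDISCHARGED; N05 ∕ N07 NOT discharged; K0⁷ ∕ K1⁹ NOT closed; counts unmoved (typed 28∕28 · discharged 8∕28); R4 closes the
conditional finite-𝕋⁴ rung `BalabanLadder.UV` ONLY; the YM mass gap (Clay) is NOT proved; nothing continuum ∕ ℝ⁴ ∕ OS.  No `def`, no `instance`, no `notation`, no `sorry`.

References: [15] (144) p. 300, (147)–(153) p. 301; [6] Thm. 4 p. 88, Prop. 6 pp. 98–99, Prop. 8 p. 100; [III] (2.1)–(2.5) pp. 254–255; [I] (0.1) p. 251, (0.3)–(0.4) pp. 252–253,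
(0.11) p. 253.
-/

set_option autoImplicit false

noncomputable section

open scoped BigOperators Matrix.Norms.L2Operator

namespace Summit.QuantumFields.YangMills.BalabanUVNodes.N07JunctionHsupOfSmallness

open Literature.MathematicalPhysics.QuantumFieldTheory.Balaban1983to89
open Literature.MathematicalPhysics.QuantumFieldTheory.Balaban1983to89.Node00
open Literature.MathematicalPhysics.QuantumFieldTheory.Balaban1983to89.B12RegularSpaces111 (gaugeU expI grad)
open B15Eq112TorusCover (cover)
open B14DomainGeom (Pt Within)
open B8Eq131Cubes (box cube tcube tLo tHi)
open B8Eq131CubesRec (tcubeZ bLoZ bHiZ)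
open B6SectAOperatorsV1 (RE dsE)
open B7Prop1Explicit (e gaugeAct)
open B7Prop1Local (AgreeOn InBox)
open B7Prop2SpecialUnitary (specialUnitaryUnits)
open BlockAveragingZd (avgIterZ ctrShift)
open B8Ineq132 (covDerivFwd InAk)
open B8Eq140Level (SideTouches)
open B8Eq138LandauZd (logCfg covLap)
open B8Eq138LandauZdRec (IsLandau138WZ)
open B8Eq119TwistedAxialRec (Restr129Z UnderZ)
open B7SectEFLinearisationRec (logCovIterZ)
open B8Eq184Proof (cfgExp)
open B8ScaledSupNorm (msup bondNorm)
open B8Eq146AExpansion (plaqCovDeriv iEta)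
open B8Eq143PlaqExpansion (pdiv)
open B7AvgGaugeCovariance (uLev)
open MatrixLog (mlog)
open Literature.MathematicalPhysics.QuantumFieldTheory.BalabanImbrieJaffe1984to88.BIJ85AxialPropagator411 (BondSpace)
open T4Continuum (T4Family)
open N07DatumCrownPhiOfRecordCrownPrecomp (DatumCrownPhiAt)
open N07Thm4RecordStructureSym152Phi (NrmSymPhiOfRecord)
open N07Thm4RecordStructureSym152PhiEG (HThm4RecSym152PhiEG)
open N07Thm4RecSym152PhiEGOfJunctionGlued (hThm4RecSym152PhiEG_of_junction_glued)
open N07DatumCrownPhiOfRecordCrownPrecomp (datumCrownPhiAt_of_recordCrownSUPrecompBody)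
open N07RecordCrownSUPrecomp (RecordCrownSUPrecomp RecordCrownSUPrecompBody recordCrownSUPrecomp_holds_of_le)
open N07JunctionHnumOfSmallness (hnum_of_smallness exists_fineLetter_small exists_kappa_choice)
open N07JunctionHJ (hJ_holds)
open N07Prop8StepCoPGridGOfPremisesG (prop8StepCoPGridGAt_of_sym152PhiEG_uniform_of_seam)
open Summit.QuantumFields.YangMills.Theorems.K0V22ZDefs (Prop8StepCoPGridGAt)
open Literature.MathematicalPhysics.QuantumFieldTheory.Balaban1983to89.B15DeterminingSets



variable (F : T4Family) (N : ℕ) [NeZero N]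

/-- ★★★ **(P1′-G) FROM THE PRE-COMPOSED RECORD CROWN** (any `N`): `RecordCrownSUPrecomp F.L N` gives MODULE 125's collar-uniform premise — `∃ md ρmin Aκ`, and for every `ρ₀` with
`ρmin ∣ ρ₀`: `κ ≤ Aκ·ρ₀`, `a₀ > 0`, `ψc ≥ 0` with `HThm4RecSym152PhiEG F N Mc (ρ₀·L) (L^md) κ a₀ (ψc·(κ·ε)²)` — by the crown body ⇒ φ-crown per `ρ₀`, MODULE 139b's `κ`∕`a₀` choices and
numerics, the junction's `hJ_holds`, and MODULE 133′. [cite: Balaban1985Variational, (144) p.300, (147)–(153) p.301; Balaban1985RegularSpaces, Thm. 4 p.88, Prop. 6 pp.98–99; Balaban1988Convergent, (2.5) p.255; Balaban1987RG1, (0.11) p.253] -/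
theorem sym152PhiEG_uniform_of_recordCrown (Mc : ℕ) (hcrown : RecordCrownSUPrecomp F.L N) :
    ∃ md ρmin : ℕ, ∃ Aκ : ℝ, 1 ≤ ρmin ∧ 0 ≤ Aκ ∧ ∀ ρ₀ : ℕ, ρmin ∣ ρ₀ → 1 ≤ ρ₀ →
      ∃ κ a₀ ψc : ℝ, 0 < κ ∧ κ ≤ Aκ * (ρ₀ : ℝ) ∧ 0 < a₀ ∧ 0 ≤ ψc ∧
        HThm4RecSym152PhiEG F N Mc (ρ₀ * F.L) (F.L ^ md) κ a₀ (fun ε j => ψc * (κ * ε j) ^ 2) := by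
  obtain ⟨B₀, c₁, ρc, M₀, N₀, R₀, hB₀, hc₁, hbody⟩ := hcrown
  obtain ⟨s, ρm, hρm, hC⟩ := datumCrownPhiAt_of_recordCrownSUPrecompBody F N hbody Mc
  obtain ⟨Aκ, hAκ, hK⟩ := exists_kappa_choice F Mc (zero_le_one.trans hB₀)
  have hL0 : (0 : ℝ) < F.L := by exact_mod_cast (F.P 0).L_pos
  refine ⟨s + 1, Nat.lcm (F.L ^ s) ρm, Aκ, Nat.pos_of_ne_zero (Nat.lcm_ne_zero (pow_ne_zero _ (F.P 0).L_pos.ne') (by omega)), hAκ,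
    fun ρ₀ hdiv hρ₀ => ?_⟩
  have hρ : F.L ≤ ρ₀ * F.L := Nat.le_mul_of_pos_left _ hρ₀
  have hdivc : ρm ∣ ρ₀ := (Nat.dvd_lcm_right _ _).trans hdiv
  have hdivs : F.L ^ s ∣ ρ₀ := (Nat.dvd_lcm_left _ _).trans hdiv
  have hsρ : F.L ^ (s + 1) ∣ ρ₀ * F.L := by rw [pow_succ]; exact mul_dvd_mul hdivs dvd_rfl
  -- the φ-crown at this collar
  have hcrownAt := hC ρ₀ hdivc hρ₀ hρ
  -- the crown's constants and their signs
  have hM1 : (1 : ℝ) ≤ (sideP (F.P 0) Mc (ρ₀ * F.L) : ℝ) := by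
    have hρ0 : 0 < ρ₀ * F.L := lt_of_lt_of_le (F.P 0).L_pos (by rw [T4Family.P_L]; exact hρ)
    have h := le_sideP (P := F.P 0) Mc hρ0
    exact_mod_cast (show 1 ≤ sideP (F.P 0) Mc (ρ₀ * F.L) by omega)
  have hB₀' : (0 : ℝ) ≤ B₀ := zero_le_one.trans hB₀
  have hCr : (0 : ℝ) ≤ 560 * (F.L : ℝ) ^ 3 * B₀ * (sideP (F.P 0) Mc (ρ₀ * F.L) : ℝ) := by positivity
  have hCω : (0 : ℝ) ≤ 20 * (F.L : ℝ) * B₀ := by positivity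
  have hω₁ : (0 : ℝ) < c₁ / 2 := by positivity
  have hα₁ : (0 : ℝ) < c₁ / (56 * (F.L : ℝ) ^ 2 * (sideP (F.P 0) Mc (ρ₀ * F.L) : ℝ)) := by positivity
  -- `κ` linear in `ρ₀`, a small fine letter, `ψc`
  obtain ⟨κ, hκ0, hκA, hκlow⟩ := hK ρ₀ hρ₀
  obtain ⟨a₀, ha₀, h2, h9, h11, h12, h16, h13, h15, h18, hα⟩ :=
    exists_fineLetter_small F N (560 * (F.L : ℝ) ^ 3 * B₀ * (sideP (F.P 0) Mc (ρ₀ * F.L) : ℝ)) (20 * (F.L : ℝ) * B₀) hω₁ hα₁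
  set W : ℝ := (830352 + 4 * (560 * (F.L : ℝ) ^ 3 * B₀ * (sideP (F.P 0) Mc (ρ₀ * F.L) : ℝ)) + 59719680 * (20 * (F.L : ℝ) * B₀)) * (F.L : ℝ) ^ 5 with hW
  have hψ : 65536 * W ^ 2 ≤ (65536 * W ^ 2 / κ ^ 2) * κ ^ 2 := by
    rw [div_mul_cancel₀ _ (pow_ne_zero 2 hκ0.ne')]
  have hnum := hnum_of_smallness F N hCr hCω h2 h9 h11 h12 h16 h13 h15 h18 hκlow hψ
  exact ⟨κ, a₀, 65536 * W ^ 2 / κ ^ 2, hκ0, hκA, ha₀, by positivity,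
    hThm4RecSym152PhiEG_of_junction_glued F N hρ hCr hCω hcrownAt hsρ hα (hJ_holds F N hρ hCr hCω hnum)⟩

/-- ★★★ **K0⁷ STUB 1 FROM THE RECORD CROWN AND HSEAM** (`N = 2`): `RecordCrownSUPrecomp F.L 2` and HSEAM (the (ii)-docket, displayed, VERBATIM MODULE 125's) give the registered
`K0V22ZDefs.Prop8StepCoPGridGAt F` — MODULE 125 ✓p753627 over `sym152PhiEG_uniform_of_recordCrown`. [cite: Balaban1985RegularSpaces, Prop. 8 p.100, Prop. 6 p.99; Balaban1985Variational, (147)–(153) p.301; Balaban1988Convergent, (2.1)–(2.5) pp.254–255] -/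
theorem prop8StepCoPGridGAt_of_recordCrown_of_seam (Mc : ℕ) (hMc : 1 ≤ Mc) (hcrown : RecordCrownSUPrecomp F.L 2)
    (hseam : ∀ (Adm : StepGuard F), ∀ (ν : Stage7Numerics) (M : ℕ) (g : ℕ → ℝ) (K k : ℕ) (s : SeqOfRecord F ν M g K k), Sect2.SeqSeparated ν.M₁ s → 0 < ν.M₁ →
        Adm ν M g K k s → 1 ≤ k →
        ∀ (δ : ℕ → ℝ),
        ∀ W : MSField (F.P K) (SU 2), Sect2.DataSmall7PTop (avOfRecord F 2 K) s.Ω (suppDomOfRecord F ν K s.Ω) k δ W →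
        ∀ U : GaugeField (F.P K) 0 (SU 2),
        AgreeOn (genSet s.Ω k) (avgFamily (avOfRecord F 2 K) U) W → IsCritOnFibre F 2 K (genSet s.Ω k) W U →
        ∀ (hkk : k ≤ (F.P K).m + (F.P K).K),
        ∀ γ : ℝ → GaugeField (F.P K) 0 (SU 2), γ 0 = U →
          DifferentiableAt ℝ (fun (t : ℝ) (b : PBond (F.P K) 0) => ((γ t b : SU 2) : Matrix (Fin 2) (Fin 2) ℂ)) 0 →
            (∀ᶠ t in nhds (0 : ℝ), ∀ (j : ℕ) (c : PBond (F.P K) j), (domainsOfSeq s.Ω k hkk).LamBond j c →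
              avgFamily (avOfRecord F 2 K) (γ t) j c = W j c) →
              ∀ a : ℝ, HasDerivAt (fun t => wilsonAction4 (γ t)) a 0 → a = 0) :
    Prop8StepCoPGridGAt F :=
  prop8StepCoPGridGAt_of_sym152PhiEG_uniform_of_seam F Mc hMc (sym152PhiEG_uniform_of_recordCrown F 2 Mc hcrown) hseam

/-- ★★★ **K0⁷ STUB 1 ⟸ HSEAM ALONE** (`N = 2`, `1 ≤ Mc`): the record crown is UNCONDITIONAL for `N ≤ 25` (dag-n05-e ✓p762215 `recordCrownSUPrecomp_holds_of_le`), so the chart side's only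
displayed premise left is HSEAM (the (ii)-docket). [cite: Balaban1985RegularSpaces, Prop. 8 p.100; Balaban1985Variational, (147)–(153) p.301; Balaban1988Convergent, (2.1)–(2.5) pp.254–255] -/
theorem prop8StepCoPGridGAt_of_seam (Mc : ℕ) (hMc : 1 ≤ Mc)
    (hseam : ∀ (Adm : StepGuard F), ∀ (ν : Stage7Numerics) (M : ℕ) (g : ℕ → ℝ) (K k : ℕ) (s : SeqOfRecord F ν M g K k), Sect2.SeqSeparated ν.M₁ s → 0 < ν.M₁ →
        Adm ν M g K k s → 1 ≤ k →
        ∀ (δ : ℕ → ℝ),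
        ∀ W : MSField (F.P K) (SU 2), Sect2.DataSmall7PTop (avOfRecord F 2 K) s.Ω (suppDomOfRecord F ν K s.Ω) k δ W →
        ∀ U : GaugeField (F.P K) 0 (SU 2),
        AgreeOn (genSet s.Ω k) (avgFamily (avOfRecord F 2 K) U) W → IsCritOnFibre F 2 K (genSet s.Ω k) W U →
        ∀ (hkk : k ≤ (F.P K).m + (F.P K).K),
        ∀ γ : ℝ → GaugeField (F.P K) 0 (SU 2), γ 0 = U →
          DifferentiableAt ℝ (fun (t : ℝ) (b : PBond (F.P K) 0) => ((γ t b : SU 2) : Matrix (Fin 2) (Fin 2) ℂ)) 0 →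
            (∀ᶠ t in nhds (0 : ℝ), ∀ (j : ℕ) (c : PBond (F.P K) j), (domainsOfSeq s.Ω k hkk).LamBond j c →
              avgFamily (avOfRecord F 2 K) (γ t) j c = W j c) →
              ∀ a : ℝ, HasDerivAt (fun t => wilsonAction4 (γ t)) a 0 → a = 0) :
    Prop8StepCoPGridGAt F :=
  prop8StepCoPGridGAt_of_recordCrown_of_seam F Mc hMc (recordCrownSUPrecomp_holds_of_le F 2 (by norm_num)) hseam

end Summit.QuantumFields.YangMills.BalabanUVNodes.N07JunctionHsupOfSmallness

end
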